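import Summits.HodgeConjecture.HodgeConjecture.Theorems.Ring2WeilCoverageCyclotomicPrincipalObstruction
import Summits.HodgeConjecture.HodgeConjecture.Theorems.Ring2WeilCoverageRealQuadraticUnitNorm
import HarnessLib

/-!
# Weil-type family coverage — the census's g = 6 NO verdicts UNCONDITIONALLY: no `ι`-compatible principal
# polarisation on `ℂ^Φ/Φ(ℤ[ζ_M])` for `(M, K) = (21, ℚ(√−3))`, `(28, ℚ(√−7))`, `(36, ℚ(√−3))`

research route conditional on HC_CM; not a corollary; Q11.4-sentence-2 already refuted in dim ≥ 3.

Ring 2, WEIL-TYPE FAMILY-COVERAGE CENSUS (`HOME/WEIL-FAMILY-COVERAGE.md` `## b01`, blocks b01.17.3 / b01.23 (C)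
«g = 6: (ℚ(ζ₂₁), ℚ(√−3)) NO, (ℚ(ζ₂₈), ℚ(√−7)) NO, (ℚ(ζ₃₆), ℚ(√−3)) NO» — the simple CM Weil-type sixfolds of
`X₂₁` type, of `(28; 1, 2, 25)` type and of `A₃₆` type with `End = ℤ[ζ_M]` are NOT principally polarisable,
pub-hsemireg t-2's R2CM anchors; owner ring2-b01), part 9 of the `Ring2WeilCoverage*` series — the hypothesis
`hN` (THEOREM L (i)) of part 7's NO theorem DISCHARGED at `M = 21, 28, 36` by part 8's elementary route
(`ℚ(ζ_M)⁺ ⊇ ℚ(√21), ℚ(√7), ℚ(√3)`; primes `3, 7, 3 ≡ 3 (mod 4)`):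

* §1 `sq_sqrtSeven` / `complexConj_sqrtSeven`: `θ₀ = ζ⁷·(1 + 2(ζ⁴ + ζ⁸ + ζ¹⁶)) = i·√−7 ∈ ℚ(ζ₂₈)` has `θ₀² = 7`
  and is real; `sq_sqrtThree` / `complexConj_sqrtThree`: `θ₀ = ζ³ + ζ³³ = ζ₁₂ + ζ₁₂⁻¹ ∈ ℚ(ζ₃₆)` has `θ₀² = 3` and is
  real; hence (part 8 §3) `norm_realUnits_pos_twentyEight` / `…_thirtySix`: every unit of `𝓞(ℚ(ζ₂₈)⁺)`,
  `𝓞(ℚ(ζ₃₆)⁺)` has norm `+1`.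
* §2 **THE THREE CENSUS ROWS, HYPOTHESIS-FREE** (for any `K` with `IsCyclotomicExtension {M} ℚ K`, `[IsCMField K]`,
  any CM type `Φ` of `K` balanced for the displayed residue set `N_K`; `n₋ = 3` at each, by `decide`):
  **`not_exists_principal_twentyOne` (`N_{√−3} = {2,5,8,11,17,20}`), `not_exists_principal_twentyEight`
  (`N_{√−7} = {3,5,13,17,19,27}`), `not_exists_principal_thirtySix` (`N_{√−3} = {5,11,17,23,29,35}`):
  `¬ ∃ ζ′, ζ′^ρ = −ζ′ ∧ (∀ φ ∈ Φ, Im φ(ζ′) > 0) ∧ CMTypeLattice.IsOfType 1 ζ′ ⊤`** — the principal CM torus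
  `ℂ^Φ/Φ(ℤ[ζ_M])` carries NO `Φ`-positive divisor of principal type, i.e. no `ι`-compatible principal
  polarisation.

HONEST FRAMING: the residue sets `N_K` are the census's «residues acting as complex conjugation on `K ⊂ ℚ(ζ_M)`»
(`t ≡ 2 (mod 3)` for `√−3 = 1 + 2ζ_3`; `t mod 7 ∉ {1,2,4}` for `√−7 = 1 + 2(η + η² + η⁴)`) — this identification is
the docstring's, the theorems hold for the displayed finite sets as such; balance `2|S_Φ ∩ N_K| = |S_Φ|` = the
`K`-signature `(3,3)` (Weil type); statements about Shimura's divisors `X_ζ′` (`ι`-compatible polarisations; for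
primitive `Φ` all polarisations — not used); levels `35, 45` (g = 12) are NOT covered by this route (`ℚ(ζ_M)⁺`'s
only real quadratic subfield is `ℚ(√5)`); nothing here is a statement about Hodge classes, `W_K`, general members
or HC; `HC_CM` is used nowhere.  No `def`, no named fact, no `sorry`.

References: [cite: Shimura1998, §14.3 Prop. 4–5, pp. 103–104]; census b01.23 (C) / b01.28 (seat-derived).
-/

noncomputable section

open Module NumberField Polynomial
open scoped nonZeroDivisors

namespace Summit.HodgeConjecture.Ring2WeilCoverage.CyclotomicUnconditional

open Literature.AlgebraicGeometry.Motives (CMType)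
open Literature.AlgebraicGeometry.HodgeTheory (IsCMTypeSet)
open Literature.NumberTheory.ComplexMultiplication
open Summit.HodgeConjecture.Ring2WeilCoverage.CyclotomicPrincipalObstruction
open Summit.HodgeConjecture.Ring2WeilCoverage.RealQuadraticUnitNorm

variable {K : Type} [Field K] [NumberField K] [IsCMField K]

/-! ### §1 `√7 ∈ ℚ(ζ₂₈)⁺` and `√3 ∈ ℚ(ζ₃₆)⁺` -/

omit [NumberField K] [IsCMField K] in
/-- **`θ₀² = 7`** for `θ₀ = ζ⁷·(1 + 2(ζ⁴ + ζ⁸ + ζ¹⁶))`, `ζ` a primitive `28`-th root of unity (`(ζ⁷)² = −1`, and the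
Gauss period of `η = ζ⁴`: `(1 + 2(η + η² + η⁴))² = −7`).
research route conditional on HC_CM; not a corollary; Q11.4-sentence-2 already refuted in dim ≥ 3. [folklore] -/
theorem sq_sqrtSeven {ζ : K} (hζ : IsPrimitiveRoot ζ 28) :
    (ζ ^ 7 * (1 + 2 * (ζ ^ 4 + ζ ^ 8 + ζ ^ 16))) ^ 2 = (7 : K) := by
  have hi : IsPrimitiveRoot (ζ ^ 7) 4 := hζ.pow (by norm_num) (by norm_num)
  have hη : IsPrimitiveRoot (ζ ^ 4) 7 := hζ.pow (by norm_num) (by norm_num)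
  have h7 := hη.geom_sum_eq_zero (by norm_num : 1 < 7)
  simp only [Finset.sum_range_succ, Finset.sum_range_zero, zero_add, pow_zero, pow_one] at h7
  have hη7 : (ζ ^ 4) ^ 7 = 1 := hη.pow_eq_one
  have hi2 : (ζ ^ 7) ^ 2 = -1 := by
    have := hi.pow (by norm_num : 0 < 4) (show 4 = 2 * 2 by norm_num)
    rw [← pow_mul] at this ⊢
    simpa using this.eq_neg_one_of_two_right
  have hB : (1 + 2 * (ζ ^ 4 + ζ ^ 8 + ζ ^ 16)) ^ 2 = -7 := by
    have e8 : ζ ^ 8 = (ζ ^ 4) ^ 2 := by ring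
    have e16 : ζ ^ 16 = (ζ ^ 4) ^ 4 := by ring
    rw [e8, e16]
    linear_combination (4 * ζ ^ 4) * hη7 + 8 * h7
  rw [mul_pow, hi2, hB]; norm_num

/-- **`θ₀ = ζ⁷·(1 + 2(ζ⁴ + ζ⁸ + ζ¹⁶))` is real** (conjugation negates `ζ⁷ = i` and the Gauss period factor).
research route conditional on HC_CM; not a corollary; Q11.4-sentence-2 already refuted in dim ≥ 3. [folklore] -/
theorem complexConj_sqrtSeven {ζ : K} (hζ : IsPrimitiveRoot ζ 28) :
    IsCMField.complexConj K (ζ ^ 7 * (1 + 2 * (ζ ^ 4 + ζ ^ 8 + ζ ^ 16))) =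
      ζ ^ 7 * (1 + 2 * (ζ ^ 4 + ζ ^ 8 + ζ ^ 16)) := by
  have hi : IsPrimitiveRoot (ζ ^ 7) 4 := hζ.pow (by norm_num) (by norm_num)
  have hη : IsPrimitiveRoot (ζ ^ 4) 7 := hζ.pow (by norm_num) (by norm_num)
  have h7 := hη.geom_sum_eq_zero (by norm_num : 1 < 7)
  simp only [Finset.sum_range_succ, Finset.sum_range_zero, zero_add, pow_zero, pow_one] at h7
  have hη7 : (ζ ^ 4) ^ 7 = 1 := hη.pow_eq_one
  have hi4 : (ζ ^ 7) ^ 4 = 1 := hi.pow_eq_one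
  have hc : IsCMField.complexConj K ζ = ζ⁻¹ :=
    complexConj_eq_inv_of_pow_eq_one (by norm_num) hζ.pow_eq_one
  have hci : IsCMField.complexConj K (ζ ^ 7) = (ζ ^ 7) ^ 3 := by
    rw [map_pow, hc, inv_pow]
    exact inv_eq_of_mul_eq_one_right (by linear_combination hi4)
  have hcη : IsCMField.complexConj K (ζ ^ 4) = (ζ ^ 4) ^ 6 := by
    rw [map_pow, hc, inv_pow]
    exact inv_eq_of_mul_eq_one_right (by linear_combination hη7)
  have e8 : ζ ^ 8 = (ζ ^ 4) ^ 2 := by ring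
  have e16 : ζ ^ 16 = (ζ ^ 4) ^ 4 := by ring
  rw [e8, e16]
  simp only [map_mul, map_add, map_one, map_ofNat, map_pow, hci, hcη]
  have hi2 : (ζ ^ 7) ^ 2 = -1 := by
    have := hi.pow (by norm_num : 0 < 4) (show 4 = 2 * 2 by norm_num)
    rw [← pow_mul] at this ⊢
    simpa using this.eq_neg_one_of_two_right
  have hA' : ((ζ ^ 7) ^ 3 : K) = -(ζ ^ 7) := by linear_combination (ζ ^ 7) * hi2
  have hB' : (1 + 2 * ((ζ ^ 4) ^ 6 + ((ζ ^ 4) ^ 6) ^ 2 + ((ζ ^ 4) ^ 6) ^ 4) : K) =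
      -(1 + 2 * (ζ ^ 4 + (ζ ^ 4) ^ 2 + (ζ ^ 4) ^ 4)) := by
    linear_combination (2 : K) * h7 +
      (2 * (ζ ^ 4) ^ 5 + 2 * (ζ ^ 4) ^ 3 * (((ζ ^ 4) ^ 7) ^ 2 + (ζ ^ 4) ^ 7 + 1)) * hη7
  rw [hA', hB']
  ring

omit [NumberField K] [IsCMField K] in
/-- **`θ₀² = 3`** for `θ₀ = ζ³ + ζ³³ = ζ₁₂ + ζ₁₂⁻¹`, `ζ` a primitive `36`-th root of unity (`x = ζ⁶` satisfies
`x² − x + 1 = 0`, so `θ₀² = x + 2 + x⁻¹ = 3`).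
research route conditional on HC_CM; not a corollary; Q11.4-sentence-2 already refuted in dim ≥ 3. [folklore] -/
theorem sq_sqrtThree {ζ : K} (hζ : IsPrimitiveRoot ζ 36) : (ζ ^ 3 + ζ ^ 33) ^ 2 = (3 : K) := by
  have h36 : ζ ^ 36 = 1 := hζ.pow_eq_one
  have hx : IsPrimitiveRoot (ζ ^ 6) 6 := hζ.pow (by norm_num) (by norm_num)
  have h18 : (ζ ^ 6) ^ 3 = -1 := by
    have := hx.pow (by norm_num : 0 < 6) (show 6 = 3 * 2 by norm_num)
    exact this.eq_neg_one_of_two_right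
  have hx1 : ζ ^ 6 ≠ -1 := by
    intro h
    have h2 : (ζ ^ 6) ^ 2 = 1 := by rw [h]; norm_num
    have := hx.pow_eq_one_iff_dvd 2 |>.mp h2
    omega
  have hq : (ζ ^ 6) ^ 2 - ζ ^ 6 + 1 = 0 := by
    have hfac : (ζ ^ 6 + 1) * ((ζ ^ 6) ^ 2 - ζ ^ 6 + 1) = 0 := by linear_combination h18
    rcases mul_eq_zero.mp hfac with h | h
    · exact absurd (eq_neg_of_add_eq_zero_left h) hx1
    · exact h
  linear_combination (ζ ^ 30 + 2) * h36 + (ζ ^ 18 + ζ ^ 12 - 1) * hq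

/-- **`θ₀ = ζ³ + ζ³³` is real** (`ζ^ρ = ζ⁻¹` swaps the two summands).
research route conditional on HC_CM; not a corollary; Q11.4-sentence-2 already refuted in dim ≥ 3. [folklore] -/
theorem complexConj_sqrtThree {ζ : K} (hζ : IsPrimitiveRoot ζ 36) :
    IsCMField.complexConj K (ζ ^ 3 + ζ ^ 33) = ζ ^ 3 + ζ ^ 33 := by
  have h36 : ζ ^ 36 = 1 := hζ.pow_eq_one
  have hc : IsCMField.complexConj K ζ = ζ⁻¹ :=
    complexConj_eq_inv_of_pow_eq_one (by norm_num) hζ.pow_eq_one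
  have h3 : IsCMField.complexConj K (ζ ^ 3) = ζ ^ 33 := by
    rw [map_pow, hc, inv_pow]
    exact inv_eq_of_mul_eq_one_right (by linear_combination h36)
  have h33 : IsCMField.complexConj K (ζ ^ 33) = ζ ^ 3 := by
    rw [map_pow, hc, inv_pow]
    exact inv_eq_of_mul_eq_one_right (by linear_combination h36)
  rw [map_add, h3, h33, add_comm]

/-- **THEOREM L (i) at `M = 28`, proved**: every unit of `𝓞(ℚ(ζ₂₈)⁺)` has positive norm (`ℚ(ζ₂₈)⁺ ∋ √7`,
`7 ≡ 3 (mod 4)`).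
research route conditional on HC_CM; not a corollary; Q11.4-sentence-2 already refuted in dim ≥ 3. [folklore] -/
theorem norm_realUnits_pos_twentyEight [IsCyclotomicExtension {28} ℚ K] {ζ : K} (hζ : IsPrimitiveRoot ζ 28)
    (v : (𝓞 (maximalRealSubfield K))ˣ) :
    0 < Algebra.norm ℚ (((v : 𝓞 (maximalRealSubfield K)) : maximalRealSubfield K)) := by
  set θ₀ : K := ζ ^ 7 * (1 + 2 * (ζ ^ 4 + ζ ^ 8 + ζ ^ 16)) with hθ₀
  have hmem : θ₀ ∈ maximalRealSubfield K :=
    (IsCMField.complexConj_eq_self_iff K θ₀).mp (complexConj_sqrtSeven hζ)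
  set θ : maximalRealSubfield K := ⟨θ₀, hmem⟩ with hθ
  have hD : θ ^ 2 = ((7 : ℕ) : maximalRealSubfield K) := by
    apply Subtype.ext
    push_cast
    exact sq_sqrtSeven hζ
  have hsq : ¬ IsSquare (7 : ℕ) := by
    rintro ⟨r, hr⟩
    have hr5 : r ≤ 3 := by nlinarith
    interval_cases r <;> omega
  rw [norm_units_eq_one_of_sq_eq hD hsq (by norm_num : Nat.Prime 7) (by norm_num) (by norm_num)
    (by norm_num) v]
  norm_num

/-- **THEOREM L (i) at `M = 36`, proved**: every unit of `𝓞(ℚ(ζ₃₆)⁺)` has positive norm (`ℚ(ζ₃₆)⁺ ∋ √3`).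
research route conditional on HC_CM; not a corollary; Q11.4-sentence-2 already refuted in dim ≥ 3. [folklore] -/
theorem norm_realUnits_pos_thirtySix [IsCyclotomicExtension {36} ℚ K] {ζ : K} (hζ : IsPrimitiveRoot ζ 36)
    (v : (𝓞 (maximalRealSubfield K))ˣ) :
    0 < Algebra.norm ℚ (((v : 𝓞 (maximalRealSubfield K)) : maximalRealSubfield K)) := by
  set θ₀ : K := ζ ^ 3 + ζ ^ 33 with hθ₀
  have hmem : θ₀ ∈ maximalRealSubfield K :=
    (IsCMField.complexConj_eq_self_iff K θ₀).mp (complexConj_sqrtThree hζ)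
  set θ : maximalRealSubfield K := ⟨θ₀, hmem⟩ with hθ
  have hD : θ ^ 2 = ((3 : ℕ) : maximalRealSubfield K) := by
    apply Subtype.ext
    push_cast
    exact sq_sqrtThree hζ
  have hsq : ¬ IsSquare (3 : ℕ) := by
    rintro ⟨r, hr⟩
    have hr5 : r ≤ 2 := by nlinarith
    interval_cases r <;> omega
  rw [norm_units_eq_one_of_sq_eq hD hsq Nat.prime_three (by norm_num) (by norm_num) (by norm_num) v]
  norm_num

/-! ### §2 The three census rows, hypothesis-free -/

open scoped Classical in
/-- **CENSUS ROW `(ℚ(ζ₂₁), ℚ(√−3))` — UNCONDITIONAL: NO `ι`-compatible principal polarisation on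
`ℂ^Φ/Φ(ℤ[ζ₂₁])`** for any CM type `Φ` of `ℚ(ζ₂₁)` balanced for `N_{√−3} = {2, 5, 8, 11, 17, 20}` (the residues
`t ≡ 2 (mod 3)`; `ℚ(√−3)`-signature `(3,3)`): the simple CM sixfolds of `X₂₁` type with `End = ℤ[ζ₂₁]` are not
principally polarisable (census b01.23 (C); part 7's theorem with `hN` discharged by part 8's
`norm_realUnits_pos_twentyOne`).
research route conditional on HC_CM; not a corollary; Q11.4-sentence-2 already refuted in dim ≥ 3. [cite: Shimura1998, §14.3 Prop. 5, p. 104] -/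
theorem not_exists_principal_twentyOne [IsCyclotomicExtension {21} ℚ K] {ζ : K} (hζ : IsPrimitiveRoot ζ 21)
    (Φ : CMType K)
    (hbal : 2 * ((Finset.univ.filter fun t : ZMod 21 =>
        ∃ σ ∈ Φ.1, σ ζ = ((ZMod.toCircle t : Circle) : ℂ)) ∩ ({2, 5, 8, 11, 17, 20} : Finset (ZMod 21))).card =
      (Finset.univ.filter fun t : ZMod 21 => ∃ σ ∈ Φ.1, σ ζ = ((ZMod.toCircle t : Circle) : ℂ)).card) :
    ¬ ∃ ζ' : K, IsCMField.complexConj K ζ' = -ζ' ∧ (∀ φ : Φ.1, 0 < (φ.1 ζ').im) ∧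
        CMTypeLattice.IsOfType (1 : (FractionalIdeal (𝓞 K)⁰ K)ˣ) ζ' ⊤ :=
  not_exists_principal_twentyOne_sqrt_neg_three hζ Φ hbal (norm_realUnits_pos_twentyOne hζ)

open scoped Classical in
/-- **CENSUS ROW `(ℚ(ζ₂₈), ℚ(√−7))` — UNCONDITIONAL: NO `ι`-compatible principal polarisation on
`ℂ^Φ/Φ(ℤ[ζ₂₈])`** for any CM type `Φ` of `ℚ(ζ₂₈)` balanced for `N_{√−7} = {3, 5, 13, 17, 19, 27}` (the units
`t` with `t mod 7 ∉ {1, 2, 4}`; `ℚ(√−7)`-signature `(3,3)`; `n₋(28, √−7) = #{3, 5, 13} = 3` odd): the simple CM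
sixfolds of `(28; 1, 2, 25)` type with `End = ℤ[ζ₂₈]` are not principally polarisable (census b01.23 (C)).
research route conditional on HC_CM; not a corollary; Q11.4-sentence-2 already refuted in dim ≥ 3. [cite: Shimura1998, §14.3 Prop. 5, p. 104] -/
theorem not_exists_principal_twentyEight [IsCyclotomicExtension {28} ℚ K] {ζ : K} (hζ : IsPrimitiveRoot ζ 28)
    (Φ : CMType K)
    (hbal : 2 * ((Finset.univ.filter fun t : ZMod 28 =>
        ∃ σ ∈ Φ.1, σ ζ = ((ZMod.toCircle t : Circle) : ℂ)) ∩ ({3, 5, 13, 17, 19, 27} : Finset (ZMod 28))).card =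
      (Finset.univ.filter fun t : ZMod 28 => ∃ σ ∈ Φ.1, σ ζ = ((ZMod.toCircle t : Circle) : ℂ)).card) :
    ¬ ∃ ζ' : K, IsCMField.complexConj K ζ' = -ζ' ∧ (∀ φ : Φ.1, 0 < (φ.1 ζ').im) ∧
        CMTypeLattice.IsOfType (1 : (FractionalIdeal (𝓞 K)⁰ K)ˣ) ζ' ⊤ := by
  have hK : IsCMTypeSet 28 ({3, 5, 13, 17, 19, 27} : Finset (ZMod 28)) := by decide
  have hg : Nat.totient 28 = 2 * (5 + 1) := by decide
  have hodd : Odd (({3, 5, 13, 17, 19, 27} : Finset (ZMod 28)).filter fun t : ZMod 28 => 2 * t.val < 28).card := by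
    decide
  exact not_exists_principal_of_norm_pos_of_odd hζ hg Φ hK hbal hodd (norm_realUnits_pos_twentyEight hζ)

open scoped Classical in
/-- **CENSUS ROW `(ℚ(ζ₃₆), ℚ(√−3))` — UNCONDITIONAL: NO `ι`-compatible principal polarisation on
`ℂ^Φ/Φ(ℤ[ζ₃₆])`** for any CM type `Φ` of `ℚ(ζ₃₆)` balanced for `N_{√−3} = {5, 11, 17, 23, 29, 35}` (the units
`t ≡ 2 (mod 3)`; `n₋(36, √−3) = #{5, 11, 17} = 3` odd): the simple CM sixfolds of `A₃₆` type with `End = ℤ[ζ₃₆]`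
are not principally polarisable (census b01.23 (C)).
research route conditional on HC_CM; not a corollary; Q11.4-sentence-2 already refuted in dim ≥ 3. [cite: Shimura1998, §14.3 Prop. 5, p. 104] -/
theorem not_exists_principal_thirtySix [IsCyclotomicExtension {36} ℚ K] {ζ : K} (hζ : IsPrimitiveRoot ζ 36)
    (Φ : CMType K)
    (hbal : 2 * ((Finset.univ.filter fun t : ZMod 36 =>
        ∃ σ ∈ Φ.1, σ ζ = ((ZMod.toCircle t : Circle) : ℂ)) ∩ ({5, 11, 17, 23, 29, 35} : Finset (ZMod 36))).card =
      (Finset.univ.filter fun t : ZMod 36 => ∃ σ ∈ Φ.1, σ ζ = ((ZMod.toCircle t : Circle) : ℂ)).card) :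
    ¬ ∃ ζ' : K, IsCMField.complexConj K ζ' = -ζ' ∧ (∀ φ : Φ.1, 0 < (φ.1 ζ').im) ∧
        CMTypeLattice.IsOfType (1 : (FractionalIdeal (𝓞 K)⁰ K)ˣ) ζ' ⊤ := by
  have hK : IsCMTypeSet 36 ({5, 11, 17, 23, 29, 35} : Finset (ZMod 36)) := by decide
  have hg : Nat.totient 36 = 2 * (5 + 1) := by decide
  have hodd : Odd (({5, 11, 17, 23, 29, 35} : Finset (ZMod 36)).filter fun t : ZMod 36 => 2 * t.val < 36).card := by
    decide
  exact not_exists_principal_of_norm_pos_of_odd hζ hg Φ hK hbal hodd (norm_realUnits_pos_thirtySix hζ)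

end Summit.HodgeConjecture.Ring2WeilCoverage.CyclotomicUnconditional

end
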